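import Literature.Topology.FourManifolds.TrisectionHandlebodyOrientable
import Literature.Topology.FourManifolds.InteriorOrientationExtension
import Literature.Topology.FourManifolds.GenusOneHandlebodyBoundary
import HarnessLib

/-!
# The handlebodies of a Gay–Kirby trisection are genus-`g` handlebodies; (g′) in genus one
from the `1`-handle lemma alone

Topic `Literature/Topology/FourManifolds`; written for the fact seat of (g′)
`exists_marking_centralSurface_of_gkTrisection` (`TrisectionFunctorGK.lean`: the central
surface of a balanced `(g, k)` Gay–Kirby trisection of a closed connected oriented smooth
4-manifold carries a marking `S_g ≃* π₁(F, x₀)`).  This file closes the orientability gap of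
the tree's predicate `IsGKTrisection` (clause (iii) gives compact connected `1`-handlebodies
`H_{ij}` but not their orientability) and assembles the genus-`1` clause of (g′):

* `IsGKTrisection.isOrientable_of_clause_iii` — **the handlebody `H_{ij}` of clause (iii) of a
  Gay–Kirby trisection of an orientable `X` is orientable**: its interior is orientable
  (`TrisectionHandlebodyOrientable.lean`: it lies as an open subset in the oriented boundary of
  the sector piece off the central surface) and orientability is decided on the interior
  (`InteriorOrientationExtension.lean`);
* `IsGKTrisection.isHandlebody_of_clause_iii`, `IsGKTrisection.exists_isHandlebody` — hence
  **`H_{ij}` is a genus-`g` handlebody** in the sense of `IsHandlebody g` (`LickorishWallace.lean`: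
  compact, connected, orientable, one `0`-handle and `g` `1`-handles), as Gay–Kirby's Def. 1
  demands ("`X_i ∩ X_j` is a genus `g` handlebody");
* `exists_marking_centralSurface_of_gkTrisection_genusOne` — **the genus-`1` clause of (g′),
  granted only the `1`-handle lemma L1** `oneHandle_nonempty_diffeomorph`
  (`HandlebodyClassification.lean`; Kosinski (1993), VI (6.6)): with
  `exists_marking_centralSurface_of_gkTrisection_genusOne_of_isOrientable`
  (`GenusOneHandlebodyBoundary.lean`: uniqueness of genus-`1` handlebodies from L1, the round
  solid torus and its torus boundary, `π₁(T²) ≅ ℤ × ℤ ≅ S_1`).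
  `exists_marking_centralSurface_of_gkTrisection_genusOne_of_oneHandle` is the same statement in
  the exact binder shape of the named fact with `g := 1`;
* `exists_marking_centralSurface_of_gkTrisection_of_model` — **(g′) for every genus `g`, reduced
  to L1 and the existence of one genus-`g` handlebody whose boundary is marked by `S_g`** (the
  marking transports along the uniqueness of handlebodies,
  `IsHandlebody.nonempty_marking_boundary_of_model`): the precise remaining input for `g ≥ 2`.

Everything here is proved; the only hypothesis beyond those of (g′) is the named fact L1, taken
in the form `(h₁ : oneHandle_nonempty_diffeomorph)`.  The clauses `g ≥ 2` of (g′) need in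
addition the identification of the boundary of a genus-`g` handlebody with the closed orientable
surface of genus `g` and `π₁(Σ_g) ≅ S_g` (Hatcher §1.2), not in the tree.

## References

* D. Gay, R. Kirby, *Trisecting 4-manifolds*, Geom. Topol. 20 (2016), Def. 1 and Remark 2
  (p. 3098). [GayKirby2016]
* A. A. Kosinski, *Differential Manifolds* (1993), VI (6.6), (11.4)(c). [Kosinski1993]
* A. Hatcher, *Algebraic Topology* (2002), Example 1.13, §1.2 p. 51. [HatcherAT2002]
-/

open scoped Manifold ContDiff Topology
open Set Function

noncomputable section

namespace Literature.Topology.FourManifolds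

universe u

/-- Local notation: `𝔼 n` is the model Euclidean space `EuclideanSpace ℝ (Fin n)`. -/
local notation "𝔼 " n:arg => EuclideanSpace ℝ (Fin n)

section Orientable

variable {X : Type u} [TopologicalSpace X] [T2Space X] [ChartedSpace (𝔼 4) X]
  [IsManifold (𝓡 4) ∞ X] {g : ℕ} {k : Fin 3 → ℕ} {S : Fin 3 → Set X}

/-- **The handlebody `H_{ij}` of a Gay–Kirby trisection of an orientable 4-manifold is
orientable** (clause-(iii) data `f : H → X` of `S i ∩ S j`, `i ≠ j`): its interior is orientable
(`IsGKTrisection.isOrientable_interiorManifold_of_clause_iii`) and an orientation of the interior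
of a manifold with boundary extends (`IsOrientable.of_interiorManifold_euclideanHalfSpace`).
Gay–Kirby, Def. 1: "`X_i ∩ X_j` is a genus `g` handlebody". [cite: GayKirby2016, Def. 1 and Remark 2 (p. 3098)] -/
theorem IsGKTrisection.isOrientable_of_clause_iii (h : IsGKTrisection X g k S)
    (ho : IsOrientable (𝓡 4) X) {i j : Fin 3} (hij : i ≠ j)
    {H : Type u} [TopologicalSpace H] [ChartedSpace (EuclideanHalfSpace 3) H]
    [IsManifold (𝓡∂ 3) ∞ H] (f : H → X)
    (hf : Manifold.IsSmoothEmbedding (𝓡∂ 3) (𝓡 4) ∞ f) (hrange : range f = S i ∩ S j)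
    (hbd : f '' (𝓡∂ 3).boundary H = ⋂ l, S l) : IsOrientable (𝓡∂ 3) H :=
  IsOrientable.of_interiorManifold_euclideanHalfSpace
    (h.isOrientable_interiorManifold_of_clause_iii ho hij f hf hrange hbd)

/-- **`H_{ij}` is a genus-`g` handlebody** (`IsHandlebody g H`: compact, connected, orientable,
one `0`-handle and `g` `1`-handles) for the clause-(iii) data of a Gay–Kirby trisection of an
orientable 4-manifold. [cite: GayKirby2016, Def. 1 and Remark 2 (p. 3098)] -/
theorem IsGKTrisection.isHandlebody_of_clause_iii (h : IsGKTrisection X g k S)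
    (ho : IsOrientable (𝓡 4) X) {i j : Fin 3} (hij : i ≠ j)
    {H : Type u} [TopologicalSpace H] [ChartedSpace (EuclideanHalfSpace 3) H]
    [IsManifold (𝓡∂ 3) ∞ H] (f : H → X) (hc : CompactSpace H) (hconn : ConnectedSpace H)
    (hh : HasHandleDecomposition 2 H (handleCount 1 g))
    (hf : Manifold.IsSmoothEmbedding (𝓡∂ 3) (𝓡 4) ∞ f) (hrange : range f = S i ∩ S j)
    (hbd : f '' (𝓡∂ 3).boundary H = ⋂ l, S l) : IsHandlebody g H :=
  ⟨hc, hconn, h.isOrientable_of_clause_iii ho hij f hf hrange hbd, hh⟩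

/-- **The double intersections of a Gay–Kirby trisection of an orientable 4-manifold are
smoothly embedded genus-`g` handlebodies with boundary the central surface** (clause (iii) of
`IsGKTrisection` upgraded by orientability). [cite: GayKirby2016, Def. 1 and Remark 2 (p. 3098)] -/
theorem IsGKTrisection.exists_isHandlebody (h : IsGKTrisection X g k S)
    (ho : IsOrientable (𝓡 4) X) {i j : Fin 3} (hij : i ≠ j) :
    ∃ (H : Type u) (_ : TopologicalSpace H) (_ : ChartedSpace (EuclideanHalfSpace 3) H)
      (_ : IsManifold (𝓡∂ 3) ∞ H) (f : H → X), IsHandlebody g H ∧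
        Manifold.IsSmoothEmbedding (𝓡∂ 3) (𝓡 4) ∞ f ∧ range f = S i ∩ S j ∧
        f '' (𝓡∂ 3).boundary H = ⋂ l, S l := by
  obtain ⟨H, _, _, f, hM, hc, hconn, hh, hf, hrange, hbd⟩ := h.2.2 i j hij
  haveI := hM
  exact ⟨H, _, _, hM, f, h.isHandlebody_of_clause_iii ho hij f hc hconn hh hf hrange hbd, hf,
    hrange, hbd⟩

end Orientable

/-! ### (g′) in genus one from L1 alone -/

/-- **The genus-`1` clause of (g′) `exists_marking_centralSurface_of_gkTrisection`, granted the
`1`-handle lemma L1** (`oneHandle_nonempty_diffeomorph`): for a balanced `(1, k)` Gay–Kirby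
trisection of a closed connected oriented smooth 4-manifold, the central surface `F` has a base
point and a marking `S_1 ≃* π₁(F, x₀)`.  Proof: `H₀₁` is orientable
(`IsGKTrisection.isOrientable_of_clause_iii`), so
`exists_marking_centralSurface_of_gkTrisection_genusOne_of_isOrientable` applies (L1 ⇒ `H₀₁`
is the solid torus, `F = f(∂H₀₁)` a torus, marked by `S_1`).  Gay–Kirby, Remark 2 ("the central
genus `g` surface `F_g = ∂H_{ij}`") in genus `1`; Hatcher, Example 1.13 and §1.2 p. 51.
[cite: GayKirby2016, Def. 1 and Remark 2 (p. 3098)] [cite: HatcherAT2002, Example 1.13 (p. 34) and §1.2 p. 51] -/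
theorem exists_marking_centralSurface_of_gkTrisection_genusOne
    (h₁ : oneHandle_nonempty_diffeomorph.{u})
    (X : Type u) [TopologicalSpace X] [T2Space X] [SecondCountableTopology X]
    [ChartedSpace (𝔼 4) X] [IsManifold (𝓡 4) ∞ X] [CompactSpace X]
    [ConnectedSpace X] (o : SmoothOrientation (𝓡 4) X) (k : ℕ) (S : Fin 3 → Set X)
    (h : IsBalancedGKTrisection X 1 k S) :
    ∃ x₀ : centralSurface S, Nonempty (SurfaceGroup 1 ≃* FundamentalGroup (centralSurface S) x₀) :=
  exists_marking_centralSurface_of_gkTrisection_genusOne_of_isOrientable h₁ h.isGKTrisection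
    fun H _ _ _ f _ _ _ hf hrange hbd =>
      h.isGKTrisection.isOrientable_of_clause_iii ⟨o⟩ (by decide) f hf hrange hbd

/-- **`(g′).{u}` with `g := 1`, in the exact binder shape of the named fact, follows from L1.**
[cite: GayKirby2016, Def. 1 and Remark 2 (p. 3098)] [cite: HatcherAT2002, Example 1.13 (p. 34) and §1.2 p. 51] -/
theorem exists_marking_centralSurface_of_gkTrisection_genusOne_of_oneHandle
    (h₁ : oneHandle_nonempty_diffeomorph.{u}) :
    ∀ (X : Type u) [TopologicalSpace X] [T2Space X] [SecondCountableTopology X]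
      [ChartedSpace (EuclideanSpace ℝ (Fin 4)) X] [IsManifold (𝓡 4) ∞ X] [CompactSpace X]
      [ConnectedSpace X] (_ : SmoothOrientation (𝓡 4) X) (k : ℕ) (S : Fin 3 → Set X),
      IsBalancedGKTrisection X 1 k S →
        ∃ x₀ : centralSurface S,
          Nonempty (SurfaceGroup 1 ≃* FundamentalGroup (centralSurface S) x₀) :=
  fun X _ _ _ _ _ _ _ o k S h => exists_marking_centralSurface_of_gkTrisection_genusOne h₁ X o k S h


/-! ### (g′) for every genus from L1 and a marked model handlebody -/

section Model

variable {g : ℕ} {V : Type u} [TopologicalSpace V] [T2Space V] [SecondCountableTopology V]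
  [ChartedSpace (EuclideanHalfSpace 3) V] [IsManifold (𝓡∂ 3) ∞ V]

/-- **Markings transport along the uniqueness of handlebodies**: granted L1, if some genus-`g`
handlebody `V` has its boundary marked by `S_g` at every point, then so does every genus-`g`
handlebody `H` (`H ≅ V` by `IsHandlebody.nonempty_diffeomorph_of_oneHandle`, Kosinski VI
(11.4)(c); diffeomorphisms restrict to the boundaries, `Diffeomorph.boundaryHomeomorph`; `π₁` is
transported along homeomorphisms, Hatcher Prop. 1.18). [cite: Kosinski1993, VI (11.4)(c)]
[cite: HatcherAT2002, Prop. 1.18 (p. 37)] -/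
theorem IsHandlebody.nonempty_marking_boundary_of_model (h₁ : oneHandle_nonempty_diffeomorph.{u})
    (hV : IsHandlebody g V)
    (hmark : ∀ z : (𝓡∂ 3).boundary V,
      Nonempty (SurfaceGroup g ≃* FundamentalGroup ((𝓡∂ 3).boundary V) z))
    {H : Type u} [TopologicalSpace H] [T2Space H] [SecondCountableTopology H]
    [ChartedSpace (EuclideanHalfSpace 3) H] [IsManifold (𝓡∂ 3) ∞ H] (hH : IsHandlebody g H)
    (z : (𝓡∂ 3).boundary H) :
    Nonempty (SurfaceGroup g ≃* FundamentalGroup ((𝓡∂ 3).boundary H) z) := by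
  obtain ⟨Φ⟩ := IsHandlebody.nonempty_diffeomorph_of_oneHandle h₁ g H V hH hV
  obtain ⟨μ⟩ := hmark (Φ.boundaryHomeomorph (by simp) z)
  exact ⟨μ.trans (Literature.AlgebraicTopology.FundamentalGroup.fundamentalGroupEquivOfHomeomorph
    (Φ.boundaryHomeomorph (by simp)) rfl).symm⟩

variable {X : Type u} [TopologicalSpace X] [T2Space X] [SecondCountableTopology X]
  {S : Fin 3 → Set X}

/-- **A genus-`g` handlebody embedded with boundary the central surface marks it**, granted L1
and a marked model of genus `g` (the genus-`g` form of
`exists_marking_centralSurface_of_isHandlebody_one`). [cite: GayKirby2016, Def. 1 and Remark 2 (p. 3098)] -/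
theorem exists_marking_centralSurface_of_isHandlebody_of_model
    (h₁ : oneHandle_nonempty_diffeomorph.{u}) (hV : IsHandlebody g V)
    (hmark : ∀ z : (𝓡∂ 3).boundary V,
      Nonempty (SurfaceGroup g ≃* FundamentalGroup ((𝓡∂ 3).boundary V) z))
    {H : Type u} [TopologicalSpace H] [ChartedSpace (EuclideanHalfSpace 3) H]
    [IsManifold (𝓡∂ 3) ∞ H] (hH : IsHandlebody g H)
    (f : H → X) (hf : Topology.IsEmbedding f) (hbdry : f '' (𝓡∂ 3).boundary H = ⋂ l, S l)
    [Nonempty (centralSurface S)] :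
    ∃ x₀ : centralSurface S, Nonempty (SurfaceGroup g ≃* FundamentalGroup (centralSurface S) x₀) := by
  haveI : T2Space H := hf.t2Space
  haveI : SecondCountableTopology H := hf.secondCountableTopology
  have hemb : Topology.IsEmbedding (fun z : (𝓡∂ 3).boundary H => f z.1) :=
    hf.comp Topology.IsEmbedding.subtypeVal
  have hrange : range (fun z : (𝓡∂ 3).boundary H => f z.1) = ⋂ l, S l := by
    rw [← hbdry]
    ext x
    constructor
    · rintro ⟨z, rfl⟩
      exact ⟨z.1, z.2, rfl⟩
    · rintro ⟨y, hy, rfl⟩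
      exact ⟨⟨y, hy⟩, rfl⟩
  let e : ↥((𝓡∂ 3).boundary H) ≃ₜ centralSurface S :=
    hemb.toHomeomorph.trans (Homeomorph.setCongr hrange)
  exact exists_marking_centralSurface_of_homeomorph e.symm
    (IsHandlebody.nonempty_marking_boundary_of_model h₁ hV hmark hH)

/-- **(g′) for genus `g`, reduced to L1 and one marked model handlebody of genus `g`.**  If the
`1`-handle lemma L1 holds and some genus-`g` handlebody `V` (in the universe of `X`) has its
boundary marked by `S_g` at every point, then the central surface of every balanced `(g, k)`
Gay–Kirby trisection of a closed connected oriented smooth 4-manifold carries a marking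
`S_g ≃* π₁(F, x₀)`: `H₀₁` is a genus-`g` handlebody (`IsGKTrisection.exists_isHandlebody`,
using the orientability proved above), hence diffeomorphic to `V`, and `F = f(∂H₀₁) ≅ ∂V`.  For
`g = 1` the model is the round solid torus (`RoundSolidTorus.lean`,
`GenusOneHandlebodyBoundary.lean`); for `g ≥ 2` a marked model (`∂V ≅ Σ_g`, `π₁(Σ_g) ≅ S_g`,
Hatcher §1.2 p. 51) is the outstanding input. [cite: GayKirby2016, Def. 1 and Remark 2 (p. 3098)]
[cite: HatcherAT2002, §1.2 p. 51] -/
theorem exists_marking_centralSurface_of_gkTrisection_of_model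
    (h₁ : oneHandle_nonempty_diffeomorph.{u}) (hV : IsHandlebody g V)
    (hmark : ∀ z : (𝓡∂ 3).boundary V,
      Nonempty (SurfaceGroup g ≃* FundamentalGroup ((𝓡∂ 3).boundary V) z))
    (X : Type u) [TopologicalSpace X] [T2Space X] [SecondCountableTopology X]
    [ChartedSpace (𝔼 4) X] [IsManifold (𝓡 4) ∞ X] [CompactSpace X]
    [ConnectedSpace X] (o : SmoothOrientation (𝓡 4) X) (k : ℕ) (S : Fin 3 → Set X)
    (h : IsBalancedGKTrisection X g k S) :
    ∃ x₀ : centralSurface S, Nonempty (SurfaceGroup g ≃* FundamentalGroup (centralSurface S) x₀) := by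
  obtain ⟨H, _, _, hM, f, hH, hf, -, hbd⟩ :=
    h.isGKTrisection.exists_isHandlebody ⟨o⟩ (show (0 : Fin 3) ≠ 1 by decide)
  haveI := hM
  haveI := h.isGKTrisection.nonempty_centralSurface
  exact exists_marking_centralSurface_of_isHandlebody_of_model h₁ hV hmark hH f hf.isEmbedding hbd

end Model

end Literature.Topology.FourManifolds

end
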